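import Summits.AtomisticToContinuum.HydrodynamicLimit.Theorems.InformationPercolationEngineLocalSecondLawInitialMatchingVelocityKL
import Summits.AtomisticToContinuum.HydrodynamicLimit.Theorems.InformationPercolationEngineLocalSecondLawInitialMatchingEnergy

/-!
# Stub B′|ML (`stub_initialMatchingOfStatics`) of the line `contact-asymmetry-information` for the crux `LocalSecondLaw`
(stmt-AtomisticToContinuum-13081) — part 5a: the entropy decomposition of a velocity slice at `s = 0`

For a one-particle density `f` of a bounded tilt `P_N(·|S)` on `[0,τ]`, the kinetic entropy density `h₁(0,y) = ∫ f log f dv`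
(`h1` of the ensemble vocabulary) decomposes, at almost every position `y`, as

  `h₁(0, y) = k(y) + n_S(y) log n_S(y) − (3/2) log(2π θ₀(y)) n_S(y) − e(y)`   (`t1_h1_eq`),

with `n_S(y) = ∫ f(0,y,v) dv`, `k(y) = ∫ f log (f/(n_S M_y)) dv ≥ 0` (velocity relative entropy, `t1_k_nonneg`) and
`e(y) = ∫ (|v − u₀(y)|²/(2θ₀(y))) f dv` (reduced peculiar energy), `M_y = M_{1,u₀(y),θ₀(y)}`.  The "good" positions are those
where the three slice functions `f`, `f log(f/(n_S M))`, `q f` are integrable in `v`, which is almost every `y` by Fubini from the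
product integrabilities of parts 1, 3b and 4b (`t1_ae_good`).  This is the bookkeeping behind the HARD (upper) direction of B′:
`∫ f log f ≤ …` needs `k` small (part 3b) and `e ≥ 3/2 n_S −` small (part 4b), the lower direction only `k ≥ 0` and `e ≤ 3/2 n_S +`
small.

References: H. Spohn, *Large Scale Dynamics of Interacting Particles* (1991), Part I §2.3.  Lead c16
(prover-line-stmt-AtomisticToContinuum-13081-c16-0).
-/

noncomputable section

open scoped BigOperators Topology Classical MeasureTheory ENNReal InnerProductSpace
open Filter Set MeasureTheory Function
open Literature.MathematicalPhysics.KineticTheory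
open Literature.Analysis.FluidPDE
open Summit.AtomisticToContinuum.HydrodynamicLimit.Theorems.LocalSecondLawNegative
open Summit.AtomisticToContinuum.HydrodynamicLimit.Theorems.LocalSecondLawLedger
open Summit.AtomisticToContinuum.HydrodynamicLimit.Theorems.LocalSecondLawContact

namespace Summit.AtomisticToContinuum.HydrodynamicLimit.Theorems.LocalSecondLawInitialMatching

variable {N : ℕ}

/-! ### Good positions -/

/-- Slices of a product-integrable function are integrable at almost every position (Fubini on `𝕋³ × ℝ³`). -/
theorem t1_ae_integrable_slice {F : T3 × V3 → ℝ} (hF : Integrable F) :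
    ∀ᵐ y : T3, Integrable fun v : V3 => F (y, v) := by
  have h : Integrable F ((volume : Measure T3).prod (volume : Measure V3)) := by
    rw [← Measure.volume_eq_prod]; exact hF
  exact h.prod_right_ae

/-- **Almost every position is good**: for the one-particle density `f` of a bounded tilt of the local Gibbs law (continuous
profiles, `σ ≤ 1/2`, `P_N(S) ≠ 0`, `τ ≥ 0`), at a.e. `y` the slices `f(0,y,·)`, `f log(f/(n_S M))(0,y,·)` and `q(y,·) f(0,y,·)` are
integrable on `ℝ³`. -/
theorem t1_ae_good {a₀ θ₀ : T3 → ℝ} {u₀ : T3 → V3} (ha : Continuous a₀) (hθ : Continuous θ₀) (hu : Continuous u₀)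
    (ha0 : ∀ x, 0 < a₀ x) (hθ0 : ∀ x, 0 < θ₀ x) {σ : ℝ} (hσ : σ ≤ 1 / 2) {τ : ℝ} (hτ : 0 ≤ τ) (Φ : Flow σ N)
    (S : Set (Phase N)) {δ'' : ℝ} (hδ : 0 < δ'') (hS : ENNReal.ofReal δ'' ≤ localGibbsLaw σ a₀ u₀ θ₀ N Φ S) (f : Pt1 → ℝ)
    (hf : IsOneParticleDensity τ (condLaw (localGibbsLaw σ a₀ u₀ θ₀ N Φ) S) Φ f) :
    ∀ᵐ y : T3, Integrable (fun v : V3 => f (0, y, v)) ∧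
      Integrable (fun v : V3 => f (0, y, v) *
        Real.log (f (0, y, v) / ((∫ w, f (0, y, w)) * localMaxwellian 1 (θ₀ y) (u₀ y) v))) ∧
      Integrable (fun v : V3 => ‖v - u₀ y‖ ^ 2 / (2 * θ₀ y) * f (0, y, v)) := by
  set μ : Measure (Phase N) := localGibbsLaw σ a₀ u₀ θ₀ N Φ with hμ
  haveI : IsProbabilityMeasure μ := isProbabilityMeasure_localGibbsLaw ha hθ hu ha0 hθ0 hσ N Φ
  haveI : IsProbabilityMeasure (condLaw μ S) := contactB_condLaw_isProbability_of_floor μ S δ'' hδ hS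
  have hS0 : μ S ≠ 0 := fun h0 => by
    rw [h0] at hS
    exact absurd (nonpos_iff_eq_zero.1 hS) (by rw [ENNReal.ofReal_eq_zero]; linarith)
  have h1 := t1_ae_integrable_slice (tv_integrable_slice_zero (condLaw μ S) Φ f hτ hf)
  have h2 := t1_ae_integrable_slice (kl_velocity_budget ha hθ hu ha0 hθ0 hσ hτ Φ S f hS0 hf).1
  obtain ⟨h3i, -⟩ := en_energy_matching ha hθ hu ha0 hθ0 hσ hτ Φ S hδ hS f hf (fun _ => (1 : ℝ)) measurable_const
    (fun _ => zero_le_one) (fun _ => le_rfl)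
  have h3 := t1_ae_integrable_slice h3i
  filter_upwards [h1, h2, h3] with y hy1 hy2 hy3
  refine ⟨hy1, hy2, ?_⟩
  refine hy3.congr (ae_of_all _ fun v => ?_)
  show 1 * (‖(y, v).2 - u₀ (y, v).1‖ ^ 2 / (2 * θ₀ (y, v).1)) * f (0, (y, v)) = ‖v - u₀ y‖ ^ 2 / (2 * θ₀ y) * f (0, y, v)
  rw [one_mul]

/-! ### The decomposition at a good position -/

/-- If the slice has zero mass it vanishes almost everywhere. -/
theorem t1_slice_ae_zero_of_mass_zero {f : Pt1 → ℝ} (hf0 : ∀ p, 0 ≤ f p) {y : T3}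
    (hy1 : Integrable fun v : V3 => f (0, y, v)) (h0 : ∫ v : V3, f (0, y, v) = 0) :
    ∀ᵐ v : V3, f (0, y, v) = 0 := by
  have := (integral_eq_zero_iff_of_nonneg (fun v => hf0 _) hy1).1 h0
  filter_upwards [this] with v hv
  exact hv

/-- **The entropy decomposition of a velocity slice** (at a good position): with `n = ∫ f(0,y,v) dv`,
`∫ f log f dv = ∫ f log(f/(n M_y)) dv + log n · n − (3/2) log(2πθ₀(y)) n − ∫ (|v−u₀(y)|²/(2θ₀(y))) f dv`
(pointwise `log f = log(f/(nM)) + log n + log M` on `{f > 0}` when `n > 0`, `log M = −(3/2)log(2πθ) − |v−u|²/(2θ)`; the case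
`n = 0` is the zero slice). -/
theorem t1_h1_eq : ∀ {θ₀ : T3 → ℝ} {u₀ : T3 → V3}, (∀ x, 0 < θ₀ x) → ∀ {f : Pt1 → ℝ}, (∀ p, 0 ≤ f p) → ∀ {y : T3}, Integrable (fun v : V3 => f (0, y, v)) → Integrable (fun v : V3 => f (0, y, v) * Real.log (f (0, y, v) / ((∫ w, f (0, y, w)) * localMaxwellian 1 (θ₀ y) (u₀ y) v))) → Integrable (fun v : V3 => ‖v - u₀ y‖ ^ 2 / (2 * θ₀ y) * f (0, y, v)) → Integrable (fun v : V3 => f (0, y, v) * Real.log (f (0, y, v))) ∧ h1 f 0 y = (∫ v : V3, f (0, y, v) * Real.log (f (0, y, v) / ((∫ w, f (0, y, w)) * localMaxwellian 1 (θ₀ y) (u₀ y) v))) + Real.log (∫ w, f (0, y, w)) * (∫ w, f (0, y, w)) - 3 / 2 * Real.log (2 * Real.pi * θ₀ y) * (∫ w, f (0, y, w)) - ∫ v : V3, ‖v - u₀ y‖ ^ 2 / (2 * θ₀ y) * f (0, y, v) := by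
  intro θ₀ u₀ hθ0 f hf0 y hy1 hy2 hy3
  set n : ℝ := ∫ w, f (0, y, w) with hn
  set F : V3 → ℝ := fun v => f (0, y, v) with hF
  set M : V3 → ℝ := localMaxwellian 1 (θ₀ y) (u₀ y) with hM
  set q : V3 → ℝ := fun v => ‖v - u₀ y‖ ^ 2 / (2 * θ₀ y) with hq
  set c : ℝ := 3 / 2 * Real.log (2 * Real.pi * θ₀ y) with hc
  have hMpos : ∀ v, 0 < M v := fun v => localMaxwellian_pos one_pos (hθ0 y) _ _
  have hn0 : 0 ≤ n := integral_nonneg fun v => hf0 _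
  -- the pointwise identity off the bad set
  have hpt : ∀ v, (F v = 0 ∨ 0 < n) →
      F v * Real.log (F v) = F v * Real.log (F v / (n * M v)) + Real.log n * F v - c * F v - q v * F v := by
    intro v hv
    by_cases hFv : F v = 0
    · rw [hFv]; simp
    · have hnpos : 0 < n := hv.resolve_left hFv
      have hFpos : 0 < F v := lt_of_le_of_ne (hf0 _) (Ne.symm hFv)
      rw [Real.log_div hFpos.ne' (mul_ne_zero hnpos.ne' (hMpos v).ne'), Real.log_mul hnpos.ne' (hMpos v).ne',
        KineticFluxLdDecayTilt.log_localMaxwellian (hθ0 y) (u₀ y) v, hc, hq]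
      ring
  -- a.e. validity
  have hae : ∀ᵐ v : V3, F v * Real.log (F v) = F v * Real.log (F v / (n * M v)) + Real.log n * F v - c * F v - q v * F v := by
    rcases hn0.eq_or_lt with h0 | hpos
    · have hz := t1_slice_ae_zero_of_mass_zero hf0 hy1 h0.symm
      filter_upwards [hz] with v hv
      exact hpt v (Or.inl hv)
    · exact ae_of_all _ fun v => hpt v (Or.inr hpos)
  -- integrability of the right-hand side
  have hR : Integrable fun v => F v * Real.log (F v / (n * M v)) + Real.log n * F v - c * F v - q v * F v :=
    ((hy2.add (hy1.const_mul _)).sub (hy1.const_mul _)).sub hy3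
  have hL : Integrable fun v => F v * Real.log (F v) := hR.congr (hae.mono fun v hv => hv.symm)
  refine ⟨hL, ?_⟩
  show ∫ v, F v * Real.log (F v) = (∫ v, F v * Real.log (F v / (n * M v))) + Real.log n * n - c * n - ∫ v, q v * F v
  have i1 : Integrable (fun v => F v * Real.log (F v / (n * M v))) := hy2
  have i2 : Integrable (fun v => Real.log n * F v) := hy1.const_mul _
  have i3 : Integrable (fun v => c * F v) := hy1.const_mul _
  have i4 : Integrable (fun v => q v * F v) := hy3
  have i12 : Integrable (fun v => F v * Real.log (F v / (n * M v)) + Real.log n * F v) := i1.add i2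
  have i123 : Integrable (fun v => F v * Real.log (F v / (n * M v)) + Real.log n * F v - c * F v) := i12.sub i3
  rw [integral_congr_ae hae, integral_sub i123 i4, integral_sub i12 i3, integral_add i1 i2, integral_const_mul,
    integral_const_mul]

/-- **Gibbs at a good position**: `0 ≤ ∫ f log(f/(n M_y)) dv` (`n = ∫ f dv`; from `f log(f/(nM)) ≥ f − n M` when `n > 0`). -/
theorem t1_k_nonneg {θ₀ : T3 → ℝ} {u₀ : T3 → V3} (hθ0 : ∀ x, 0 < θ₀ x) {f : Pt1 → ℝ} (hf0 : ∀ p, 0 ≤ f p) {y : T3}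
    (hy1 : Integrable fun v : V3 => f (0, y, v))
    (hy2 : Integrable fun v : V3 => f (0, y, v) *
      Real.log (f (0, y, v) / ((∫ w, f (0, y, w)) * localMaxwellian 1 (θ₀ y) (u₀ y) v))) :
    0 ≤ ∫ v : V3, f (0, y, v) * Real.log (f (0, y, v) / ((∫ w, f (0, y, w)) * localMaxwellian 1 (θ₀ y) (u₀ y) v)) := by
  set n : ℝ := ∫ w, f (0, y, w) with hn
  have hn0 : 0 ≤ n := integral_nonneg fun v => hf0 _
  have hMpos : ∀ v, 0 < localMaxwellian 1 (θ₀ y) (u₀ y) v := fun v => localMaxwellian_pos one_pos (hθ0 y) _ _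
  rcases hn0.eq_or_lt with h0 | hpos
  · -- zero slice
    have hz := t1_slice_ae_zero_of_mass_zero hf0 hy1 h0.symm
    rw [integral_congr_ae (g := fun _ => (0 : ℝ)) (hz.mono fun v hv => by simp [hv]), integral_zero]
  · have hMi : Integrable (localMaxwellian 1 (θ₀ y) (u₀ y)) := integrable_localMaxwellian (hθ0 y) (u₀ y)
    calc (0 : ℝ) = ∫ v : V3, (f (0, y, v) - n * localMaxwellian 1 (θ₀ y) (u₀ y) v) := by
          rw [integral_sub hy1 (hMi.const_mul _), integral_const_mul, integral_localMaxwellian_one (hθ0 y), mul_one,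
            ← hn, sub_self]
      _ ≤ _ := integral_mono (hy1.sub (hMi.const_mul _)) hy2 fun v =>
          (kl_mul_log_ratio_ge (hf0 _) hn0 (hMpos v)).2 hpos

/-- The kinetic entropy density `y ↦ h₁(0, y)` is measurable. -/
theorem t1_measurable_h1 {σ τ : ℝ} {ν : Measure (Phase N)} {Φ : Flow σ N} {f : Pt1 → ℝ}
    (hf : IsOneParticleDensity τ ν Φ f) : Measurable fun y : T3 => h1 f 0 y := by
  have hm : Measurable fun p : T3 × V3 => f (0, p) * Real.log (f (0, p)) :=
    (tv_measurable_slice_zero hf).mul (Real.measurable_log.comp (tv_measurable_slice_zero hf))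
  exact (hm.stronglyMeasurable.integral_prod_right').measurable

end Summit.AtomisticToContinuum.HydrodynamicLimit.Theorems.LocalSecondLawInitialMatching

end
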